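import Mathlib
import Summits.NavierStokesRegularity.NavierStokesRegularity.Theorems.TaoLadderRungTwoFlatConditionalBlock
import Summits.NavierStokesRegularity.NavierStokesRegularity.Theorems.TaoLadderRungTwoFlatCapturePhase
import Summits.NavierStokesRegularity.NavierStokesRegularity.Theorems.TaoLadderRungTwoFlatEntryNearWeighted
import HarnessLib

/-!
# THE ENTRY HOP `n = N₀` OF THE SPLIT R54 TUBE FROM A CONDITIONAL BLOCK ENCLOSURE, IN ONE CALL
  (helper for the K_A♭ parent item stmt-NavierStokesRegularity-22987 `FlatGapCertificatesV2`, route TaoLadderRungTwoFlat;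
  cell harvest/h2-tao-ladder, p1 g25; the row list theory-1's CAPTURE-E2-70 producer fills at the entry strobe (LADDER §69.3,
  §70.7: A69-2 rows `ρ_N(k)`, `M_u(k)`, `δ₁`, `M_ω`, carrier), with the deviation profile now PRODUCED from the conditional block row
  of `…ConditionalBlock` (A70-3) instead of booked)

* `entryHop_of_block` — `TubeStepClockWith ∧ TubeStepEnvelopeWith ∧ TubeStepLandWith` at `n = N₀` for the choice rule and the
  split behind clause `splitBcl P (behindR54 P θ' W_b) δ_s i₀ u⋆`, from: the CONDITIONAL block row (block `[k_L, k_H+1]`, boxes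
  `±4G_{k_H+1}` / `±2ℓ_b`), the checkpoint state `ζ(N₀)` vanishing below the block, the block-bottom level and its closing
  inequality (`ι = η(N₀) + r`), the zero-padded reference with plain hull `M_Z` and profile `D_k ≤ D`, the per-hop window, and the
  reference rows of `tubeStepLandWith_entry_of_devProfileW` (…EntryNearWeighted: carrier/anchor, shape `δ₁`, `M_ω`, domination,
  `u⋆` tail, per-shell near rows `ρ_N(k)`, `M_u(k)` with the `e^{θ_V(k+K)}`-weighted near budget, behind energy, core/slot budgets,
  ahead window rows, hull, cut schedule) plus the clock carrier row `(1+σ)f + D₁ ≤ |Z_{i₀1}|` and the envelope rows.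

HONEST FRAMING: composition only, over the cell's typed frame (MODEL lattice); the conditional block row and every reference row are
BOOKED HYPOTHESES; nothing certified; no item closed; nothing about the Navier–Stokes equations.
-/

noncomputable section

-- the sub-problem namespace repeats the summit name by design (D-0017)
set_option linter.dupNamespace false

namespace Summit.NavierStokesRegularity.NavierStokesRegularity.Theorems.HopTube

open Set Finset Filter Topology Literature.Analysis.FluidPDE Literature.Analysis.FluidPDE.TaoCascade MirrorPulse RenormFrame QuadPolar

section Block

variable {ε ε₀ : ℝ}

set_option maxHeartbeats 800000 in
/-- **THE ENTRY HOP FROM A CONDITIONAL BLOCK ENCLOSURE.** See the module docstring for the row list.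
[cite: Tao2016AveragedNS, §4 Lemma 4.1, §5, §6.2 Prop. 6.3 (ix), §6.3–6.4 Props. 6.4–6.5 (statement shape); cell LADDER §50, §52, §54, §62, §64.2, §69–§70 (A69-2, A70-3)] -/
theorem entryHop_of_block (P : TubeSchedule) {δs : ℕ → ℝ} {θ' : ℝ} {Wb : ℕ → ℝ} {σ : ℝ} {i₀ : Fin 2}
    {X₀ : Fin 2 → ℝ} {w : ℤ → ℝ} {r θ₀ c₀ t₀ : ℝ} {ζ : ℕ → Fin 2 → ℤ → ℝ} {ustar : Fin 2 → ℤ → ℝ}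
    {good : ℕ → (Fin 2 → ℤ → ℝ → ℝ) → ℝ → Prop}
    (hε : 0 ≤ ε) (hε₀ : 0 < ε₀) (hc₀ : 0 < c₀)
    (hζ0 : ζ 0 = datumState i₀ X₀) (hη0 : 0 ≤ P.η 0) (hk₁ : 1 ≤ P.k₁) (hr0 : 0 ≤ r)
    (hw1 : ∀ k, 1 ≤ w k) (hAstar : 0 < P.Astar) (hg : 1 ≤ P.g) (hb : 1 ≤ P.b)
    (hθV : 0 ≤ P.θV) (hθ₀ : 0 ≤ θ₀) (hθ₀1 : θ₀ ≤ 1) (hAFL : 0 < 1 - θ₀ * ε₀) (hσ : 0 ≤ σ) (hσA : 1 + σ ≤ P.Astar)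
    (hγ : 0 ≤ P.γ (P.N₀ + 1)) (hδ : 0 ≤ P.δ (P.N₀ + 1)) (hδs : 0 ≤ δs (P.N₀ + 1)) (hv : 0 ≤ P.v (P.N₀ + 1))
    (hWb : 0 ≤ Wb (P.N₀ + 1))
    -- THE BLOCK `[k_L, k_H + 1]`: conditional enclosure row, checkpoint support, block-bottom level, closing inequality
    {kL kH : ℤ} {Z : Fin 2 → ℤ → ℝ → ℝ} {Dk G Ω env₀ : ℤ → ℝ} {MZ D ℓb BL Vtop : ℝ}
    (hLB : kL ≤ kH + 1) (hk₁H : (P.k₁ : ℤ) ≤ kH + 2) (hGpos : 0 < G (kH + 1)) (hℓb : 0 < ℓb) (hBL : 0 ≤ BL)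
    (hVtop : 0 ≤ Vtop)
    (hblock : ∀ z S₀ s S F, InTubeWith P (splitBcl P (behindR54 P θ' Wb) δs i₀ ustar) i₀ X₀ w r ζ ustar P.N₀ z →
      (∀ i k, w k * |S₀ i k - z i k| ≤ r) → 0 < s →
      PseudoFlowOnShift shiftSetFlat s ε₀ (mirrorTable ε ε) 0 0 S₀ (fun i k => (1 / 2) * S₀ i k ^ 2) (fun _ _ => 0) S F →
        ∀ t ∈ Icc 0 c₀, t ≤ s →
          (∀ s' ∈ Icc 0 t, ∀ i : Fin 2,
              |S i (kH + 1 + 1) s'| ≤ 4 * G (kH + 1) ∧ ∀ k : ℤ, k < kL → |S i k s'| ≤ 2 * ℓb) →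
            ∀ s' ∈ Icc 0 t, ∀ (i : Fin 2) (k : ℤ), kL ≤ k → k ≤ kH + 1 → |S i k s' - Z i k s'| ≤ Dk k)
    (hζb : ∀ (i : Fin 2) (k : ℤ), k < kL → ζ P.N₀ i k = 0)
    (hBLrow : ∀ s ∈ Icc 0 c₀, ∀ i : Fin 2, |Z i kL s| + Dk kL ≤ BL)
    (hcloseB : P.η P.N₀ + r + c₀ * clockW ε₀ (kL - 1) * tableAbsSum shiftSetFlat (mirrorTable ε ε) * max (2 * ℓb) BL ^ 2
      ≤ ℓb)
    -- the ZERO-PADDED reference: plain hull, profile `D_k ≤ D` dominating the levels off the block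
    (hZb : ∀ (i : Fin 2) (k : ℤ) (s : ℝ), k < kL → Z i k s = 0)
    (hZa : ∀ (i : Fin 2) (k : ℤ) (s : ℝ), kH + 1 < k → Z i k s = 0)
    (hDb : ∀ k : ℤ, k < kL → ℓb ≤ Dk k) (hDa : ∀ k : ℤ, kH + 1 < k → 2 * G (kH + 1) ≤ Dk k) (hDk : ∀ k, Dk k ≤ D)
    (hZp : ∀ i k, ∀ t ∈ Icc 0 c₀, |Z i k t| ≤ MZ)
    -- good section times in the per-hop window `[t_lo, t_hi] ⊆ (0, c₀]`
    {tlo thi : ℝ} (htlo : 0 < tlo)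
    (hex : ∀ z S₀ τ S F, HopPremiseWith P (splitBcl P (behindR54 P θ' Wb) δs i₀ ustar) shiftSetFlat ε₀ i₀ (mirrorTable ε ε) X₀ w
      r c₀ ζ ustar P.N₀ z S₀ τ S F → ∃ t, good P.N₀ S t)
    (hwin : ∀ z S₀ τ S F, HopPremiseWith P (splitBcl P (behindR54 P θ' Wb) δs i₀ ustar) shiftSetFlat ε₀ i₀ (mirrorTable ε ε) X₀ w
      r c₀ ζ ustar P.N₀ z S₀ τ S F → ∀ t, good P.N₀ S t → tlo ≤ t ∧ t ≤ thi) (hthi : thi ≤ c₀)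
    -- reference rows: clock carrier, anchor carrier, shape, domination, tails, near (per shell, weighted budget), behind, budgets
    {δ₁ Mω δ₂ δ₃' : ℝ} {ρN Mu : ℤ → ℝ}
    (hrefK : ∀ t ∈ Icc tlo thi, (1 + σ) * (1 + ε₀) ^ (-θ₀) + Dk 1 ≤ |Z i₀ 1 t|)
    (hrefC : ∀ t ∈ Icc tlo thi, P.Astar * (1 - P.γ (P.N₀ + 1)) * (1 + ε₀) ^ (-θ₀) + D ≤ |Z i₀ 1 t|)
    (hrefW : ∀ t ∈ Icc tlo thi, ∀ (i : Fin 2) (k : ℤ), -(P.K : ℤ) ≤ k → k < (P.k₁ : ℤ) →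
      MirrorPulse.geomGauge P.g P.b i k * |Z i (1 + k) t - |Z i₀ 1 t| / P.Astar * ustar i k| ≤ δ₁)
    (hMω : ∀ (i : Fin 2) (k : ℤ), -(P.K : ℤ) ≤ k → k < (P.k₁ : ℤ) → MirrorPulse.geomGauge P.g P.b i k * |ustar i k| ≤ Mω)
    (hdom : ∀ (i : Fin 2) (k : ℤ), (P.k₁ : ℤ) ≤ k →
      MirrorPulse.geomGauge P.g P.b i k * (max ((1 + ε₀) ^ (-θ₀)) ((MZ + D) / P.Astar) * r) ≤ 8 * δ₂ * w k)
    (hutail : ∀ (i : Fin 2) (k : ℤ), (P.k₁ : ℤ) ≤ k → MirrorPulse.geomGauge P.g P.b i k * |ustar i k| ≤ δ₃')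
    (hrefN : ∀ t ∈ Icc tlo thi, ∀ (i : Fin 2) (k : ℤ), -(P.D : ℤ) ≤ k → k ≤ -(P.K : ℤ) - 1 →
      |Z i (1 + k) t - |Z i₀ 1 t| / P.Astar * ustar i k| ≤ ρN k)
    (hMu : ∀ (i : Fin 2) (k : ℤ), -(P.D : ℤ) ≤ k → k ≤ -(P.K : ℤ) - 1 → |ustar i k| ≤ Mu k)
    (hrefB : ∀ t ∈ Icc tlo thi, ∀ L : ℕ,
      R54.behindEnergy P.K L θ' (fun i k => |Z i (1 + k) t| + D) ≤ ((1 + ε₀) ^ (-θ₀)) ^ 2 * Wb (P.N₀ + 1))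
    (hbudC : max (P.g ^ P.k₁ * D + δ₁ + D / P.Astar * Mω) (δ₂ + (MZ + D) / P.Astar * δ₃')
      ≤ (1 + ε₀) ^ (-θ₀) * P.δ (P.N₀ + 1))
    (hbudS : max (P.g ^ P.k₁ * D + δ₁ + D / P.Astar * Mω) (δ₂ + (MZ + D) / P.Astar * δ₃')
      ≤ (1 + ε₀) ^ (-θ₀) * δs (P.N₀ + 1))
    (hbudN : ∑ k ∈ Finset.Icc (-(P.D : ℤ)) (-(P.K : ℤ) - 1),
        Real.exp (P.θV * ((k : ℝ) + P.K)) * (Dk (1 + k) + ρN k + Dk 1 / P.Astar * Mu k) ^ 2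
      ≤ ((1 + ε₀) ^ (-θ₀)) ^ 2 * P.v (P.N₀ + 1))
    -- envelope rows, ahead window rows, hull, cut schedule
    (hG0 : ∀ j, kH < j → 0 ≤ G j)
    (hrefE : ∀ s ∈ Icc 0 c₀, ∀ (i : Fin 2) (k : ℤ), k ≤ kH + 1 → (1 / 2) * (|Z i k s| + D) ^ 2 ≤ env₀ k)
    (hrefA : ∀ t ∈ Icc tlo thi, ∀ (i : Fin 2) (k : ℤ), (P.k₁ : ℤ) ≤ k → k ≤ kH →
      8 * (w k * (|Z i (1 + k) t| + Dk (1 + k))) ≤ r * (1 - θ₀ * ε₀))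
    (hrefV : ∀ t ∈ Icc 0 c₀, |Z 1 (kH + 1) t| + D ≤ Vtop)
    (hΩ : ∀ j, kH < j → ∀ N : Finset ℤ, (∀ m ∈ N, j < m) → ∑ m ∈ N, (w m)⁻¹ ^ 2 ≤ Ω j)
    (hGΩ : ∀ j, kH < j → 2 * (9 / 8 * r) ^ 2 * Ω j ≤ G j ^ 2)
    (hclose0 : 4 / 3 * c₀ * clock ε₀ (kH + 1) * Vtop * (Vtop + 2 * ε * G (kH + 1)) < G (kH + 1))
    (hcloseG : ∀ j, kH + 1 ≤ j →
      4 / 3 * c₀ * clock ε₀ (j + 1) * (2 * G j) * (2 * G j + 2 * ε * G (j + 1)) < G (j + 1))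
    (hGr : ∀ k, kH < k → 8 * (w k * (2 * G k)) ≤ r * (1 - θ₀ * ε₀))
    (henvA : ∀ m : ℤ, kH + 1 < m → 2 * G (m - 1) ^ 2 ≤ env₀ m) :
    TubeStepClockWith P (splitBcl P (behindR54 P θ' Wb) δs i₀ ustar) (choiceRule P i₀ ε₀ θ₀ t₀ good) shiftSetFlat σ ε₀ i₀
        (mirrorTable ε ε) X₀ w r θ₀ c₀ ζ ustar P.N₀ ∧
      TubeStepEnvelopeWith P (splitBcl P (behindR54 P θ' Wb) δs i₀ ustar) (choiceRule P i₀ ε₀ θ₀ t₀ good) shiftSetFlat ε₀ i₀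
        (mirrorTable ε ε) X₀ w r c₀ env₀ ζ ustar P.N₀ ∧
      TubeStepLandWith P (splitBcl P (behindR54 P θ' Wb) δs i₀ ustar) (choiceRule P i₀ ε₀ θ₀ t₀ good) shiftSetFlat ε₀ i₀
        (mirrorTable ε ε) X₀ w r c₀ ζ ustar P.N₀ := by
  have hε' : (-1 : ℝ) < ε₀ := by linarith
  have hw0 : ∀ k, 0 < w k := fun k => lt_of_lt_of_le one_pos (hw1 k)
  -- state-level inputs below and beyond the block, from the clauses of `H(N₀)` (a capture slot)
  have hι : ∀ z S₀ : Fin 2 → ℤ → ℝ, InTubeWith P (splitBcl P (behindR54 P θ' Wb) δs i₀ ustar) i₀ X₀ w r ζ ustar P.N₀ z →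
      (∀ i k, w k * |S₀ i k - z i k| ≤ r) → ∀ (i : Fin 2) (k : ℤ), k < kL → |S₀ i k| ≤ P.η P.N₀ + r :=
    fun z S₀ hz hkick => init_below_of_captureClause P (capture_of_inTubeWith_le P le_rfl hζ0 hη0 hk₁ hr0 hz).1 hζb hw1 hkick
  have hinit : ∀ z S₀ : Fin 2 → ℤ → ℝ, InTubeWith P (splitBcl P (behindR54 P θ' Wb) δs i₀ ustar) i₀ X₀ w r ζ ustar P.N₀ z →
      (∀ i k, w k * |S₀ i k - z i k| ≤ r) →
        ∀ N : Finset ℤ, (∀ m ∈ N, kH + 1 < m) → ∑ m ∈ N, ∑ i : Fin 2, S₀ i m ^ 2 ≤ G (kH + 1) ^ 2 :=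
    fun z S₀ hz hkick N hN =>
      (initialTail_le_of_clauses P hw0 hr0 (capture_of_inTubeWith_le P le_rfl hζ0 hη0 hk₁ hr0 hz).2 hkick
        (j := kH + 1) (by omega) hN (hΩ (kH + 1) (by omega) N hN)).trans (hGΩ (kH + 1) (by omega))
  have hrefV' : ∀ t ∈ Icc 0 c₀, |Z 1 (kH + 1) t| + Dk (kH + 1) ≤ Vtop := fun t ht => by
    linarith [hrefV t ht, hDk (kH + 1)]
  -- the deviation profile of every premise (the interface bootstrap of `…ConditionalBlock`)
  have hdevk := devProfile_of_conditionalBlock P hε hε₀ hc₀ hLB hGpos hℓb hVtop hBL hblock hrefV' hinit hclose0 hι hBLrow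
    hcloseB hZb hZa hDb hDa
  have hdev : ∀ z S₀ τ S F, HopPremiseWith P (splitBcl P (behindR54 P θ' Wb) δs i₀ ustar) shiftSetFlat ε₀ i₀ (mirrorTable ε ε)
      X₀ w r c₀ ζ ustar P.N₀ z S₀ τ S F → ∀ (i : Fin 2) (k : ℤ), ∀ s ∈ Icc 0 c₀, |S i k s - Z i k s| ≤ D :=
    fun z S₀ τ S F h i k s hs => (hdevk z S₀ τ S F h i k s hs).trans (hDk k)
  have hwin' : ∀ z S₀ τ S F, HopPremiseWith P (splitBcl P (behindR54 P θ' Wb) δs i₀ ustar) shiftSetFlat ε₀ i₀ (mirrorTable ε ε)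
      X₀ w r c₀ ζ ustar P.N₀ z S₀ τ S F → ∀ t, good P.N₀ S t → tlo ≤ t ∧ t ≤ c₀ :=
    fun z S₀ τ S F h t ht => ⟨(hwin z S₀ τ S F h t ht).1, (hwin z S₀ τ S F h t ht).2.trans hthi⟩
  refine ⟨?_, ?_, ?_⟩
  · refine tubeStepClockWith_of_carrier P hε' hσ hσA hex
      (fun z S₀ τ S F h t ht => ⟨htlo.trans_le (hwin' z S₀ τ S F h t ht).1, (hwin' z S₀ τ S F h t ht).2⟩)
      fun z S₀ τ S F h t ht => ?_
    obtain ⟨h1, h2⟩ := hwin z S₀ τ S F h t ht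
    have hd := hdevk z S₀ τ S F h i₀ 1 t ⟨htlo.le.trans h1, h2.trans hthi⟩
    have := abs_sub_abs_le_abs_sub (Z i₀ 1 t) (S i₀ 1 t)
    rw [abs_sub_comm] at hd
    linarith [hrefK t ⟨h1, h2⟩]
  · exact tubeStepEnvelopeWith_of_continuity P hε hε₀ le_rfl hc₀ hζ0 hη0 hk₁ hr0 hw1 hdev hex hwin' hk₁H hVtop hG0 hrefE hrefV
      hΩ hGΩ hclose0 hcloseG henvA
  · exact tubeStepLandWith_entry_of_devProfileW P hε hε₀ hc₀ hζ0 hη0 hk₁ hr0 hw1 hAstar hg hb hθV hθ₀ hθ₀1 hAFL hγ hδ hδs hv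
      hWb hZp hDk hdevk htlo hex hwin hthi hrefC hrefW hMω hdom hutail hrefN hMu hrefB hbudC hbudS hbudN hk₁H hVtop hG0 hrefA
      hrefV' hΩ hGΩ hclose0 hcloseG hGr

end Block

end Summit.NavierStokesRegularity.NavierStokesRegularity.Theorems.HopTube

end
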